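import Summits.KontsevichZagierPeriods.KontsevichZagierPeriods.Theorems.KzOnePeriodsG0DerivSegments

/-!
# KontsevichZagierPeriods — kz1p (R1)–(R5) derivations, part 3: loop symbols

Cell pub-kz1p, seat b2b-kz1p-2, gen 12 (kz1p v1.3; PROCEDURE.md §4d; LEAN-IN-TREE rule).  [cite: HuberWustholz2022, §13.1 (p. 120)];
no named facts, no `sorry`.

A small positive circle of radius `ρ` around the pole `a_c` of the input form (radius below the distance to the other
poles): `exists_loopPath`, and the reduction `span_loopSymbol` of its symbol to `rc_c · [𝔾ₘ, y dx, ℓ(2πi)]`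
((R1), (R3), (R4) to `𝔾ₘ`, the standard loop, and non-winding circles are null-homotopic in the slit plane).
-/

noncomputable section

open scoped BigOperators Real
open MvPolynomial Set Complex
open Literature.NumberTheory.Transcendental
open Literature.NumberTheory.Transcendental.CurvePeriods

namespace Summit.KontsevichZagierPeriods.KzOnePeriods.G0Derivation

local notation3 "InSpanRel " c:arg => ∃ (k : ℕ) (ρ : Fin k → (PeriodSymbol →₀ ℂ))
  (a : Fin k → ℂ), (∀ l, IsElementaryRelation (ρ l)) ∧ (∀ l, IsAlgebraic ℚ (a l)) ∧
    c = ∑ l, a l • ρ l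

local notation3 (prettyPrint := false) "𝔾m" => (⟨2, 1, ![X 0 * X 1 - 1]⟩ : CurveData)

local notation3 "logSym " E:arg => (⟨⟨2, 1, ![X 0 * X 1 - 1]⟩, isSmoothAffineCurve_mulGroup,
  ![X 1, 0], hasAlgCoeffs_ydx, E⟩ : PeriodSymbol)

section InputForms

variable {r : ℕ}

local notation3 (prettyPrint := false) "ZP " a:arg =>
  (⟨2, 1, ![X 1 * ∏ i, (X 0 - C (a i)) - 1]⟩ : CurveData)

/-! ### Loop symbols: a small circle around one pole -/

/-- `1 + u e^{iθ}` with `|u| < 1` lies in the slit plane. [folklore] -/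
theorem one_add_mul_exp_mem_slitPlane {u : ℂ} (hu : ‖u‖ < 1) (t : ℝ) :
    1 + u * exp (2 * π * I * t) ∈ slitPlane := by
  refine mem_slitPlane_of_norm_lt_one ?_
  rw [norm_mul, show 2 * (π : ℂ) * I * t = ((2 * π * t : ℝ) : ℂ) * I by push_cast; ring,
    Complex.norm_exp_ofReal_mul_I, mul_one]
  exact hu

/-- **The circle `x(t) = a_c + ρ e^{2πit}` (radius `ρ` smaller than the distance from `a_c` to the
other `a_j`) is a closed `C¹` path on `Z_a`** based at the algebraic point `x = a_c + ρ`. [folklore] -/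
theorem exists_loopPath {a : Fin r → ℂ} (ha : ∀ i, IsAlgebraic ℚ (a i)) (c : Fin r) {ρ : ℝ}
    (hρ : 0 < ρ) (hρalg : IsAlgebraic ℚ (ρ : ℂ))
    (hsmall : ∀ j, j ≠ c → ρ ^ 2 < Complex.normSq (a c - a j)) :
    ∃ γ : CurvePath (ZP a), ∀ t, γ.toFun t =
      ![a c + ρ * exp (2 * π * I * t), (∏ i, (a c + ρ * exp (2 * π * I * t) - a i))⁻¹] := by
  have hlin : ContDiff ℝ 1 fun t : ℝ => 2 * (π : ℂ) * I * (t : ℂ) := contDiff_const.mul ofRealCLM.contDiff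
  have hx : ContDiff ℝ 1 fun t : ℝ => a c + ρ * exp (2 * π * I * t) :=
    contDiff_const.add (contDiff_const.mul hlin.cexp)
  have hfac : ∀ (t : ℝ) i, a c + ρ * exp (2 * π * I * t) - a i ≠ 0 := by
    intro t i
    by_cases hi : i = c
    · subst hi
      rw [add_sub_cancel_left]
      exact mul_ne_zero (ofReal_ne_zero.2 hρ.ne') (exp_ne_zero _)
    · intro h0
      have e : a c - a i = -(ρ * exp (2 * π * I * t)) := by linear_combination h0
      have hn : Complex.normSq (a c - a i) = ρ ^ 2 := by
        rw [e, Complex.normSq_neg, Complex.normSq_mul, Complex.normSq_ofReal,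
          show 2 * (π : ℂ) * I * t = ((2 * π * t : ℝ) : ℂ) * I by push_cast; ring,
          Complex.normSq_eq_norm_sq (exp _), Complex.norm_exp_ofReal_mul_I]
        ring
      exact absurd (hsmall i hi) (by rw [hn]; exact lt_irrefl _)
  have hne : ∀ t : ℝ, ∏ i, (a c + ρ * exp (2 * π * I * t) - a i) ≠ 0 := fun t =>
    Finset.prod_ne_zero_iff.2 fun i _ => hfac t i
  have hprod : ContDiffOn ℝ 1 (fun t : ℝ => ∏ i, (a c + ρ * exp (2 * π * I * t) - a i)) (Icc 0 1) :=
    contDiffOn_prod fun i _ => (hx.sub contDiff_const).contDiffOn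
  have halg0 : IsAlgebraic ℚ (a c + ρ * exp (2 * π * I * ((0 : ℝ) : ℂ))) := by
    simpa using (ha c).add hρalg
  have halg1 : IsAlgebraic ℚ (a c + ρ * exp (2 * π * I * ((1 : ℝ) : ℂ))) := by
    simpa [exp_two_pi_mul_I] using (ha c).add hρalg
  refine ⟨{ toFun := fun t => ![a c + ρ * exp (2 * π * I * t), (∏ i, (a c + ρ * exp (2 * π * I * t) - a i))⁻¹]
            contDiffOn := ?_
            mem_points := ?_
            algebraic_zero := ?_
            algebraic_one := ?_ }, fun t => rfl⟩
  · refine contDiffOn_pi.2 fun i => ?_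
    fin_cases i
    · simpa using hx.contDiffOn
    · exact (hprod.inv fun t _ => hne t).congr fun t _ => by simp
  · intro t _
    rw [mem_points_puncturedLine_iff]
    simp only [Matrix.cons_val_one, Matrix.cons_val_zero, Matrix.cons_val_fin_one]
    exact inv_mul_cancel₀ (hne t)
  · intro i
    fin_cases i
    · simpa using halg0
    · simpa using (isAlgebraic_finsetProd _ _ fun i _ => halg0.sub (ha i)).inv
  · intro i
    fin_cases i
    · simpa using halg1
    · simpa using (isAlgebraic_finsetProd _ _ fun i _ => halg1.sub (ha i)).inv

/-- **A circle not enclosing `0` is null-homologous in `ℂ*`**: if the first coordinate of a path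
`γ` on `𝔾ₘ` is `v + ρ e^{2πit}` with `ρ < |v|`, then `(𝔾ₘ, y dx, γ) ∼ 0` (winding number `0`:
the explicit `C¹` logarithm `Log v + Log(1 + (ρ/v) e^{2πit})` is periodic). [folklore] -/
theorem span_circle_not_winding {v : ℂ} {ρ : ℝ} (hρ : 0 < ρ) (hv : ρ ^ 2 < Complex.normSq v)
    (γ : CurvePath 𝔾m) (hγ : ∀ t ∈ Icc (0 : ℝ) 1, γ.toFun t 0 = v + ρ * exp (2 * π * I * t)) :
    InSpanRel (Finsupp.single (logSym γ) (1 : ℂ)) := by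
  have hv0 : v ≠ 0 := by
    intro h; rw [h, map_zero] at hv; exact absurd hv (not_lt.2 (sq_nonneg ρ))
  set u : ℂ := (ρ : ℂ) / v with hu_def
  have hu : ‖u‖ < 1 := by
    rw [hu_def, norm_div, Complex.norm_real, Real.norm_eq_abs, abs_of_pos hρ, div_lt_one (norm_pos_iff.2 hv0)]
    have h1 : ρ ^ 2 < ‖v‖ ^ 2 := by rwa [← Complex.normSq_eq_norm_sq]
    exact (abs_lt_of_sq_lt_sq' h1 (norm_nonneg v)).2
  -- the explicit logarithm
  set L : ℝ → ℂ := fun t => log v + log (1 + u * exp (2 * π * I * t)) with hL_def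
  have hslit : ∀ t : ℝ, 1 + u * exp (2 * π * I * t) ∈ slitPlane := one_add_mul_exp_mem_slitPlane hu
  have hlin : ContDiff ℝ 1 fun t : ℝ => 2 * (π : ℂ) * I * (t : ℂ) := contDiff_const.mul ofRealCLM.contDiff
  have hin : ContDiff ℝ 1 fun t : ℝ => 1 + u * exp (2 * π * I * t) :=
    contDiff_const.add (contDiff_const.mul hlin.cexp)
  have hLC : ContDiff ℝ 1 L := by
    refine contDiff_const.add (contDiff_iff_contDiffAt.2 fun t => ?_)
    have hlog : ContDiffAt ℂ 1 log (1 + u * exp (2 * π * I * t)) := contDiffAt_log (hslit t)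
    exact (hlog.restrict_scalars ℝ).comp t hin.contDiffAt
  have hLx : ∀ t ∈ Icc (0 : ℝ) 1, exp (L t) = γ.toFun t 0 := by
    intro t ht
    rw [hγ t ht, hL_def]
    simp only
    rw [exp_add, exp_log hv0, exp_log (slitPlane_ne_zero (hslit t)), hu_def]
    field_simp
  have hw : L 1 = L 0 + (0 : ℤ) * (2 * π * I) := by
    simp [hL_def, exp_two_pi_mul_I]
  obtain ⟨Λ, ρ₁, ρ₂, ρ₃, hΛ, h₁, h₂, h₃, he⟩ :=
    single_loop_eq_single_stdLoop ![X 1, 0] hasAlgCoeffs_ydx γ L hLC hLx 0 hw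
  have hconst : IsElementaryRelation (Finsupp.single (logSym Λ) 1) :=
    isElementaryRelation_single_of_const isSmoothAffineCurve_mulGroup _ hasAlgCoeffs_ydx Λ
      ![γ.toFun 0 0, (γ.toFun 0 0)⁻¹] fun t _ => by rw [hΛ]; simp
  obtain ⟨k, ρ', c, hρ', hc, hsum⟩ := span_add (span_of_rel hconst) (span_sub (span_sub
    (span_smul (by exact_mod_cast isAlgebraic_nat (R := ℚ) (A := ℂ) 2 : IsAlgebraic ℚ (2 : ℂ))
      (span_of_rel h₃)) (span_of_rel h₁)) (span_of_rel h₂))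
  refine ⟨k, ρ', c, hρ', hc, ?_⟩
  rw [he, ← hsum, two_smul, two_smul]

/-- **The circle of radius `ρ ∈ ℚ̄ ∩ ℝ_{>0}` around `0` is the logarithm symbol `ℓ(2πi)`**:
`(𝔾ₘ, y dx, ρ e^{2πit}) ∼ ℓ(2πi)` ((R4) base change to the standard loop, which *is* the
exponential path `E_{0, 2πi}`). [cite: HuberWustholz2022, §10.1 (p. 96)] -/
theorem span_circle_logSym {ρ : ℝ} (hρ : 0 < ρ) (hρalg : IsAlgebraic ℚ (ρ : ℂ))
    (γ : CurvePath 𝔾m) (hγ : ∀ t ∈ Icc (0 : ℝ) 1, γ.toFun t =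
      ![ρ * exp (2 * π * I * t), (ρ : ℂ)⁻¹ * exp (-(2 * π * I * t))])
    (E : CurvePath 𝔾m)
    (hE : ∀ t, E.toFun t = ![exp ((1 - t) * 0 + t * (2 * π * I)), exp (-((1 - t) * 0 + t * (2 * π * I)))]) :
    InSpanRel (Finsupp.single (logSym γ) (1 : ℂ) - Finsupp.single (logSym E) 1) := by
  have hρ0 : (ρ : ℂ) ≠ 0 := ofReal_ne_zero.2 hρ.ne'
  obtain ⟨Λ, hΛ⟩ := exists_stdLoop hρalg hρ0 1
  obtain ⟨Λ₁, hΛ₁⟩ := exists_stdLoop isAlgebraic_one one_ne_zero 1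
  have hγΛ : ∀ t ∈ Icc (0 : ℝ) 1, Λ.toFun t = γ.toFun t := by
    intro t ht
    rw [hΛ, hγ t ht]
    simp only [Int.cast_one, one_mul]
  have h₁ := mem_span_sub_of_eqOn isSmoothAffineCurve_mulGroup ![X 1, 0] hasAlgCoeffs_ydx γ Λ hγΛ
  have h₂ := rel_stdLoop_baseChange hρalg hρ0 1 Λ Λ₁ hΛ hΛ₁
  have hE₁ : Λ₁ = E := by
    refine CurvePath.eq_of_toFun_eq fun t => ?_
    rw [hΛ₁, hE]
    funext i
    fin_cases i
    · simp only [Int.cast_one, one_mul, Fin.zero_eta, Matrix.cons_val_zero]; ring_nf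
    · simp only [Int.cast_one, one_mul, inv_one, Fin.mk_one, Matrix.cons_val_one,
        Matrix.cons_val_fin_one]; ring_nf
  rw [hE₁] at h₂
  obtain ⟨k, ρ', c, hρ', hc, hsum⟩ := span_add h₁ (span_of_rel h₂)
  exact ⟨k, ρ', c, hρ', hc, by rw [← hsum]; abel⟩

/-- **kz1p moves (R1)+(R3)+(R4)+(A-hom) for one loop symbol.** For the input form `ω` on `Z_a`
and the circle `γ` of radius `ρ` around `a_c` (radius below the distance to the other poles):
`(Z_a, ω, γ) ∼ r_c · ℓ(2πi)`. [cite: HuberWustholz2022, §13.1 (A)–(B) (p. 120), §10.1 (p. 96)] -/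
theorem span_loopSymbol {a : Fin r → ℂ} (ha : ∀ i, IsAlgebraic ℚ (a i)) {rc : Fin r → ℂ}
    (hrc : ∀ i, IsAlgebraic ℚ (rc i)) {d : ℕ} {pc : Fin d → ℂ} (hpc : ∀ k, IsAlgebraic ℚ (pc k))
    (c : Fin r) {ρ : ℝ} (hρ : 0 < ρ) (hρalg : IsAlgebraic ℚ (ρ : ℂ))
    (hsmall : ∀ j, j ≠ c → ρ ^ 2 < Complex.normSq (a c - a j)) (γ : CurvePath (ZP a))
    (hγ : ∀ t ∈ Icc (0 : ℝ) 1, γ.toFun t =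
      ![a c + ρ * exp (2 * π * I * t), (∏ i, (a c + ρ * exp (2 * π * I * t) - a i))⁻¹])
    (E : CurvePath 𝔾m)
    (hE : ∀ t, E.toFun t = ![exp ((1 - t) * 0 + t * (2 * π * I)), exp (-((1 - t) * 0 + t * (2 * π * I)))]) :
    InSpanRel (Finsupp.single (⟨ZP a, isSmoothAffineCurve_puncturedLine ha, inputForm a rc pc,
        hasAlgCoeffs_inputForm ha hrc hpc, γ⟩ : PeriodSymbol) (1 : ℂ) -
      rc c • Finsupp.single (logSym E) (1 : ℂ)) := by
  classical
  have hZ : (ZP a).IsSmoothAffineCurve := isSmoothAffineCurve_puncturedLine ha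
  have h0I : (0 : ℝ) ∈ Icc (0 : ℝ) 1 := ⟨le_rfl, zero_le_one⟩
  have h1I : (1 : ℝ) ∈ Icc (0 : ℝ) 1 := ⟨zero_le_one, le_rfl⟩
  have hcl : γ.toFun 1 = γ.toFun 0 := by
    rw [hγ 0 h0I, hγ 1 h1I]; simp [exp_two_pi_mul_I]
  -- the factors of `∏ (x − aᵢ)` along the circle
  have hfac : ∀ t ∈ Icc (0 : ℝ) 1, ∀ i, γ.toFun t 0 - a i ≠ 0 := by
    intro t ht i
    have hm := (mem_points_puncturedLine_iff a _).1 (γ.mem_points t ht)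
    have hpr : ∏ j, (γ.toFun t 0 - a j) ≠ 0 := fun h => by rw [h, mul_zero] at hm; exact zero_ne_one hm
    exact (Finset.prod_ne_zero_iff.1 hpr) i (Finset.mem_univ i)
  -- the forms
  have hb := hasAlgCoeffs_basicForm ha
  have hS := hasAlgCoeffs_polarPart ha hrc
  have hQ := hasAlgCoeffs_polyPrim hpc
  have hdQ : ∀ k, HasAlgCoeffs (formD (polyPrim pc) k) := hQ.formD
  have r₂ := IsElementaryRelation.add _ hZ γ (inputForm a rc pc) _ _ (hasAlgCoeffs_inputForm ha hrc hpc)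
    hS hdQ rfl
  have r₃ := span_single_sum_smul (ZP a) hZ γ Finset.univ _ hb rc hrc hS
  have r₄ := IsElementaryRelation.exact _ hZ γ (polyPrim pc) hQ _ hdQ rfl
  rw [hcl, sub_self, zero_smul, sub_zero] at r₄
  -- the polar parts: only the pole `a_c` is encircled
  have hpol : ∀ i, InSpanRel (Finsupp.single (⟨ZP a, hZ,
      ![X 1 * ∏ j ∈ Finset.univ.erase i, (X 0 - C (a j)), 0], hb i, γ⟩ : PeriodSymbol) (1 : ℂ) -
      (if i = c then (1 : ℂ) else 0) • Finsupp.single (logSym E) (1 : ℂ)) := by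
    intro i
    obtain ⟨γ', hγ', hrel⟩ := exists_rel_basicForm_mulGroup ha i γ
    by_cases hic : i = c
    · subst hic
      rw [if_pos rfl, one_smul]
      have hγ'' : ∀ t ∈ Icc (0 : ℝ) 1, γ'.toFun t =
          ![ρ * exp (2 * π * I * t), (ρ : ℂ)⁻¹ * exp (-(2 * π * I * t))] := by
        intro t ht
        have hm := (mem_points_puncturedLine_iff a _).1 (γ.mem_points t ht)
        have hx : γ.toFun t 0 = a i + ρ * exp (2 * π * I * t) := by rw [hγ t ht]; simp
        rw [hγ']
        have e1 : γ.toFun t 0 - a i = ρ * exp (2 * π * I * t) := by rw [hx]; ring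
        have hp : (γ.toFun t 0 - a i) * ∏ j ∈ Finset.univ.erase i, (γ.toFun t 0 - a j) =
            ∏ j, (γ.toFun t 0 - a j) :=
          Finset.mul_prod_erase (s := Finset.univ) (f := fun j => γ.toFun t 0 - a j) (Finset.mem_univ i)
        have e2 : γ.toFun t 1 * ∏ j ∈ Finset.univ.erase i, (γ.toFun t 0 - a j) =
            (ρ : ℂ)⁻¹ * exp (-(2 * π * I * t)) := by
          have hne := hfac t ht i
          have : γ.toFun t 1 * ∏ j ∈ Finset.univ.erase i, (γ.toFun t 0 - a j) = (γ.toFun t 0 - a i)⁻¹ := by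
            refine eq_inv_of_mul_eq_one_left ?_
            rw [← hm, ← hp]; ring
          rw [this, e1, mul_inv, exp_neg]
        rw [e1, e2]
      have hs := span_circle_logSym hρ hρalg γ' hγ'' E hE
      obtain ⟨k, ρ', cf, hρ', hcf, hsum⟩ := span_add (span_of_rel hrel) hs
      exact ⟨k, ρ', cf, hρ', hcf, by rw [← hsum]; abel⟩
    · rw [if_neg hic, zero_smul, sub_zero]
      have hγ'0 : ∀ t ∈ Icc (0 : ℝ) 1, γ'.toFun t 0 = (a c - a i) + ρ * exp (2 * π * I * t) := by
        intro t ht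
        rw [hγ', hγ t ht]
        simp only [Matrix.cons_val_zero]
        ring
      have hs := span_circle_not_winding hρ (hsmall i hic) γ' hγ'0
      obtain ⟨k, ρ', cf, hρ', hcf, hsum⟩ := span_add (span_of_rel hrel) hs
      exact ⟨k, ρ', cf, hρ', hcf, by rw [← hsum]; abel⟩
  have r₆ : InSpanRel (∑ i, rc i • (Finsupp.single (⟨ZP a, hZ,
      ![X 1 * ∏ j ∈ Finset.univ.erase i, (X 0 - C (a j)), 0], hb i, γ⟩ : PeriodSymbol) (1 : ℂ) -
      (if i = c then (1 : ℂ) else 0) • Finsupp.single (logSym E) (1 : ℂ))) :=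
    span_finsetSum _ _ fun i _ => span_smul (hrc i) (hpol i)
  have hδ : ∑ i, rc i • ((if i = c then (1 : ℂ) else 0) • Finsupp.single (logSym E) (1 : ℂ)) =
      rc c • Finsupp.single (logSym E) (1 : ℂ) := by
    rw [Finset.sum_eq_single c (fun j _ hj => by rw [if_neg hj, zero_smul, smul_zero])
      (fun h => absurd (Finset.mem_univ c) h), if_pos rfl, one_smul]
  obtain ⟨k, ρ', cf, hρ', hcf, hsum⟩ := span_add (span_add (span_add (span_of_rel r₂) r₃)
    (span_of_rel r₄)) r₆
  refine ⟨k, ρ', cf, hρ', hcf, ?_⟩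
  rw [← hδ, ← hsum]
  simp only [smul_sub, Finset.sum_sub_distrib]
  abel

end InputForms

end Summit.KontsevichZagierPeriods.KzOnePeriods.G0Derivation

end
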